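import Summits.BirchSwinnertonDyer.Rank1Residual.Additive.CyclotomicInertiaSqrtPStar
import Summits.BirchSwinnertonDyer.Rank1Residual.AdditivePotMult.RamifiedOrdinaryLinePotMult
import Summits.BirchSwinnertonDyer.Rank1Residual.X2.TorsionComparison
import HarnessLib

/-!
# `(E[p^∞]/C)^{ker κ ⊓ I_p} = 0` for the ramified ordinary line of an `e = 2` ADDITIVE prime — GV
# Remark (2.9)'s case ("Thus, if `D^{I_p} = 0`, the conclusion is still true") DISCHARGED for the
# cell's twist-transported data: X4♯(G-ord, e = 2) and X3♯(G-ord, e = 2) at every odd `p`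
# (cell `b2b-bsdres`, team n1011, seat p12 (gen 4); row T-E3g-GV29 FILE 4; discharges the displayed
# binder `h0` of `GreenbergVatsalTorsionRamifiedQuotient` / `GreenbergVatsalTransferRamifiedQuotient`
# on those rows; p10's `RamifiedOrdinaryLineTransport` / `GordRamifiedOrdinaryLine` BY NAME)

HONEST FRAMING (cell `b2b-bsdres`, run/shared/lean/b2b/bsd-rank1-residual/, verbatim in every
file): the goal of the cell is to DELETE the COMBINATION-SHAPED residual classes of the
Birch–Swinnerton-Dyer formula for ALL analytic-rank `≤ 1` elliptic curves over `ℚ` — "full BSD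
formula for every rank `≤ 1` curve in class `C`" assembled STRICTLY from published theorems — so
that the rank-`≤ 1` remainder becomes exactly the CONSTRUCTION-SHAPED classes, which are TYPED
(missing-input `Prop`s), NOT attempted. This is not "finishing BSD". Team n1011: research routes on
CONSTRUCTION-SHAPED classes; prove what is provable now; no claim beyond stated classes; census
output = EVIDENCE, never a Literature fact; RESIDUAL-MAP marks UNCHANGED; nothing is booked by this
file. THEOREMS ONLY: no definition, no named fact; p10's transport / datum files and eisenstein-p2's
reduction datum are consumed BY NAME and untouched.

## What and why

The cell's ramified ordinary line `C ⊂ E[p^∞]` at an additive prime of semistability defect `e = 2`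
is the TRANSPORT `e(C_v(V))` of Greenberg's good-ordinary datum of the twist model `V`,
`W = C • V^{(p*)}`, along a SIGN-equivariant `e : V[p^∞] ≃ W[p^∞]` which is ANTI-equivariant exactly
at the `σ` flipping `√p*` (p10 `Additive/RamifiedOrdinaryLineTransport`, `Additive/GordRamifiedOrdinaryLine`).
Inertia acts TRIVIALLY on `V[p^∞]/C_v(V)` (`X2.GreenbergVatsalReductionDatum.reductionDatum_htriv`), so
on `D = W[p^∞]/e(C_v(V))` an inertia element acts by `+1` or `−1` according to its sign on `√p*`.
FILE 3 (`CyclotomicInertiaSqrtPStar`) produced an inertia element `τ` INSIDE `ker κ` (the tower's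
Galois group) flipping `√p*`; `τ` acts as `−1` on `D`, and a `p`-primary group (`p` odd) has no
non-zero element fixed by `−1`. Hence `D^{ker κ ⊓ I_v} = 0` — the hypothesis `h0` of FILES 1–2.

* §1 `transport_gr_invariants_eq_zero` — GENERIC (any number field `K`, any sign-equivariant
  transport `L₂` of a datum `L` with inertia trivial on `M₁/L.plus` and `2` invertible modulo
  `L.plus`): an inertia element `τ` in the anti-equivariant branch lying in `H` kills
  `H⁰(H ⊓ I_v, M₂/L₂.plus)`.
* §2 over `ℚ`: `gr_invariants_eq_zero_of_transport_reductionDatum` (any `ℤ_p`-extension `κ`, `p` odd,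
  the `p*`-twist transport of the reduction datum) and the EXISTENCE forms
  `exists_isRamifiedOrdinaryLine_gr_invariants_eq_zero_of_goodOrd_pStar_twist`,
  **`ClassX4Gord.exists_isRamifiedOrdinaryLine_gr_invariants_eq_zero`**,
  **`ClassX3Gord.exists_isRamifiedOrdinaryLine_gr_invariants_eq_zero`**: on X4♯(G-ord, e = 2) /
  X3♯(G-ord, e = 2) there is a ramified ordinary line `L` at `v ∋ p` with
  `∀ a ∈ invariants (inertiaIn κ.kerSubgroup v) L.Gr, a = 0`.

* §3 the (M) rows, modulo the PUBLISHED Tate uniformisation A40/A41 exactly as in p07's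
  `RamifiedOrdinaryLinePotMult` (whose QUOTIENT SHAPE clause "`res σ ∉ galRange ℚ(√p*) ⟹ res σ•x + x ∈ C`"
  is consumed BY NAME): `gr_invariants_eq_zero_of_smul_add_mem` (generic: ONE inertia element of `H`
  acting as `−1` modulo `C` kills `H⁰(H ⊓ I_v, E[p^∞]/C)`, `p` odd),
  **`PotMult.exists_isRamifiedOrdinaryLine_gr_invariants_eq_zero`**,
  **`ClassX4M.exists_isRamifiedOrdinaryLine_gr_invariants_eq_zero`**,
  **`ClassX3M.exists_isRamifiedOrdinaryLine_gr_invariants_eq_zero`**.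

NOT here: the mod-`p` intrinsic line `C[p] = E[p]^{I}` (true at `p = 3` only; cc-typer-1's
`TwistedOrdinaryLineAt`), anything about `Sel`.

References: [GreenbergVatsal2000] §2 Remark (2.9); [EmertonPollackWeston2006] §3.1 (eq:ordes);
[GreenbergLNM1716] §2 pp. 62–63, 69; Washington GTM 83 §13.1.
-/

set_option autoImplicit false

noncomputable section

open scoped Classical NumberField

open NumberField IsDedekindDomain Field WeierstrassCurve
  Literature.NumberTheory.GaloisRepresentations Literature.NumberTheory.EllipticCurves
  Literature.NumberTheory.EllipticCurves.GreenbergSelmer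
  Literature.NumberTheory.EllipticCurves.EmertonPollackWeston2006
  Literature.NumberTheory.EllipticCurves.Rank1Residual
  Summit.BirchSwinnertonDyer.Rank1Residual.X2.TorsionComparison

universe u

namespace Summit.BirchSwinnertonDyer.Rank1Residual.Additive

/-! ### §1 Generic: an anti-equivariant inertia element of `H` kills `H⁰(H ⊓ I_v, M₂/e(C))` -/

section Generic

variable {K : Type u} [Field K] [NumberField K] {v : HeightOneSpectrum (𝓞 K)}
  {M₁ M₂ : Type u} [AddCommGroup M₁] [AddCommGroup M₂]
  [DistribMulAction (absoluteGaloisGroup K) M₁] [DistribMulAction (absoluteGaloisGroup K) M₂]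
  (L : LocalDatum K M₁ v) (e : M₁ ≃+ M₂) (L₂ : LocalDatum K M₂ v)
  (hL₂ : ∀ m : M₂, m ∈ L₂.plus ↔ e.symm m ∈ L.plus)

include hL₂ in
/-- **`H⁰(H ⊓ I_v, M₂/e(C)) = 0` from ONE anti-equivariant inertia element of `H`.** Let `L₂` be a
transport of the datum `L` (`C = L.plus`) along `e : M₁ ≃ M₂`, with inertia acting TRIVIALLY on `M₁/C`
and `2` invertible modulo `C`. If `τ ∈ I_v` lies in `H` and `e` is ANTI-equivariant at `τ`
(`e(τ•m) = −τ•e(m)`), then every element of `M₂/e(C)` fixed by `H ⊓ I_v` is `0`: for `m = e(m₁)`,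
`τ•m − m ∈ e(C)` reads `−(τ m₁ − m₁) − 2 m₁ ∈ C`, so `2 m₁ ∈ C`, `m₁ ∈ C`, `m ∈ e(C)`.
[cite: GreenbergVatsal2000, §2 Remark (2.9)] [cite: EmertonPollackWeston2006, §3.1 (eq:ordes) (arXiv:math/0404484 p. 17)] -/
theorem transport_gr_invariants_eq_zero (H : Subgroup (absoluteGaloisGroup K))
    (htriv : ∀ x ∈ inertia v, ∀ m : M₁, x • m - m ∈ L.plus)
    (h2 : ∀ m : M₁, (2 : ℕ) • m ∈ L.plus → m ∈ L.plus)
    {τ : absoluteGaloisGroup (v.adicCompletion K)} (hτ : τ ∈ absInertia (v.adicCompletion K))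
    (hτH : absGaloisRestrict K (v.adicCompletion K) τ ∈ H)
    (hneg : ∀ m : M₁, e (absGaloisRestrict K (v.adicCompletion K) τ • m) =
      -(absGaloisRestrict K (v.adicCompletion K) τ • e m)) :
    ∀ a ∈ invariants (inertiaIn H v) L₂.Gr, a = 0 := by
  intro a ha
  obtain ⟨m, rfl⟩ := L₂.grMk_surjective a
  set x := absGaloisRestrict K (v.adicCompletion K) τ with hx
  have hxI : x ∈ inertia v := Subgroup.mem_map.2 ⟨τ, hτ, rfl⟩
  have hxD : x ∈ decomp v := (mem_decomp_iff v x).2 ⟨τ, rfl⟩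
  -- the element `x` of `H ⊓ I_v ≤ D_v` fixes the class of `m`
  let xI : inertiaIn H v := ⟨⟨x, hxD⟩, (mem_inertiaIn_iff H v _).2 ⟨hτH, hxI⟩⟩
  have hfix : xI • L₂.grMk m = L₂.grMk m := (mem_invariants_iff _).1 ha xI
  rw [Subgroup.smul_def, LocalDatum.smul_grMk] at hfix
  change L₂.grMk (x • m) = L₂.grMk m at hfix
  -- so `x • m - m ∈ e(C)`, i.e. `e⁻¹ (x • m - m) ∈ C`
  have hmem : x • m - m ∈ L₂.plus := by
    rw [← L₂.ker_grMk, AddMonoidHom.mem_ker, map_sub, hfix, sub_self]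
  rw [hL₂, map_sub] at hmem
  -- `e⁻¹ (x • m) = -(x • e⁻¹ m)` by anti-equivariance
  have hanti : e.symm (x • m) = -(x • e.symm m) := by
    apply e.injective
    rw [e.apply_symm_apply, map_neg, hneg, e.apply_symm_apply, neg_neg]
  rw [hanti] at hmem
  -- `2 • e⁻¹ m = -( -(x • m₁) - m₁ ) - ... ∈ C`
  have h2m : (2 : ℕ) • e.symm m ∈ L.plus := by
    have hsplit : (2 : ℕ) • e.symm m =
        -((-(x • e.symm m) - e.symm m) + (x • e.symm m - e.symm m)) := by
      rw [two_nsmul]; abel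
    rw [hsplit]
    exact neg_mem (add_mem hmem (htriv x hxI (e.symm m)))
  have hm : m ∈ L₂.plus := (hL₂ m).2 (h2 _ h2m)
  rw [← AddMonoidHom.mem_ker, L₂.ker_grMk]
  exact hm

end Generic

/-! ### §2 Over `ℚ`: the `p*`-twist transport of Greenberg's reduction datum -/

section Rat

variable (p : ℕ) [hp : Fact p.Prime] (κ : ZpExtension ℚ p) {v : HeightOneSpectrum (𝓞 ℚ)}

/-- **`(W[p^∞]/e(C_v(V)))^{ker κ ⊓ I_v} = 0` for the transported reduction datum** (`V` globally
minimal, good ordinary at the odd `p`; `W = C • V^{(p*)}`-type transport: `e` sign-equivariant,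
anti-equivariant at every `σ` flipping `√p*`; `κ` ANY `ℤ_p`-extension of `ℚ`): FILE 3's inertia
element of `ker κ` flipping `√p*`, eisenstein-p2's `reductionDatum_htriv`, p10's `mem_of_two_nsmul_mem`,
§1. [cite: GreenbergVatsal2000, §2 Remark (2.9)] [cite: GreenbergLNM1716, §2 pp. 62–63 and p. 69] -/
theorem gr_invariants_eq_zero_of_transport_reductionDatum (hp2 : p ≠ 2)
    (V : WeierstrassCurve ℚ) [V.IsElliptic] [V.IsGloballyMinimal]
    (hpv : ((p : ℕ) : 𝓞 ℚ) ∈ v.asIdeal) (hΔ : ¬ (p : ℤ) ∣ minimalDiscriminantInt V)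
    {W : WeierstrassCurve ℚ} (e : ↥(V.geomPrimaryTorsion p) ≃+ ↥(W.geomPrimaryTorsion p))
    (heneg : ∀ σ : absoluteGaloisGroup ℚ,
      σ • geomSqrt ((-1 : ℚ) ^ (p / 2) * p) = -geomSqrt ((-1 : ℚ) ^ (p / 2) * p) →
        ∀ m, e (σ • m) = -(σ • e m))
    (L : LocalDatum ℚ ↥(W.geomPrimaryTorsion p) v)
    (hL : ∀ m, m ∈ L.plus ↔ e.symm m ∈ (X2.GreenbergVatsalReductionDatum.reductionDatum V p hpv hΔ).plus) :
    ∀ a ∈ invariants (inertiaIn κ.kerSubgroup v) L.Gr, a = 0 := by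
  obtain ⟨τ, hτ, hκτ, hflip⟩ :=
    exists_mem_absInertia_kappa_eq_one_smul_geomSqrt_pStar_eq_neg p κ hp2 hpv
  exact transport_gr_invariants_eq_zero _ e L hL κ.kerSubgroup
    (X2.GreenbergVatsalReductionDatum.reductionDatum_htriv V p hpv hΔ)
    (fun _ hm ↦ mem_of_two_nsmul_mem hp2 _ hm) hτ (ZpExtension.mem_kerSubgroup.2 hκτ)
    (heneg _ hflip)

/-- **EXISTENCE with the Remark-(2.9) clause: a ramified ordinary line `L` on a `ℚ`-model
`W = C • V^{(p*)}` of the ramified quadratic twist of a good-ordinary `V` (`p` odd) with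
`(W[p^∞]/L.plus)^{ker κ ⊓ I_v} = 0`** — p10's `exists_isRamifiedOrdinaryLine_of_goodOrd_pStar_twist`
re-run with the extra conclusion (same `e`, same transport).
[cite: EmertonPollackWeston2006, §3.1 (eq:ordes) (arXiv:math/0404484 p. 17)] [cite: GreenbergVatsal2000, §2 Remark (2.9)] -/
theorem exists_isRamifiedOrdinaryLine_gr_invariants_eq_zero_of_goodOrd_pStar_twist (hp2 : p ≠ 2)
    (V : WeierstrassCurve ℚ) [V.IsElliptic] [V.IsGloballyMinimal] {W : WeierstrassCurve ℚ}
    (hCW : ∃ C : VariableChange ℚ, C • V.quadraticTwist ((-1 : ℚ) ^ (p / 2) * p) = W)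
    (hV : GoodOrd V p) (hpv : ((p : ℕ) : 𝓞 ℚ) ∈ v.asIdeal) :
    ∃ L : LocalDatum ℚ ↥(W.geomPrimaryTorsion p) v, IsRamifiedOrdinaryLine W p L ∧
      ∀ a ∈ invariants (inertiaIn κ.kerSubgroup v) L.Gr, a = 0 := by
  have hΔ : ¬ (p : ℤ) ∣ minimalDiscriminantInt V :=
    V.not_dvd_minimalDiscriminantInt_of_hasGoodReductionAtPrime' p hV.1
  have hd := intValuation_pStar p hpv
  have hd0 : (((((-1 : ℤ) ^ (p / 2) * p : ℤ)) : ℚ)) ≠ 0 := by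
    intro h
    have hdz : ((((-1 : ℤ) ^ (p / 2) * p : ℤ)) : 𝓞 ℚ) = 0 := by exact_mod_cast (Int.cast_eq_zero.1 h)
    rw [hdz, map_zero] at hd
    exact WithZero.zero_ne_coe hd
  have hCW' : ∃ C : VariableChange ℚ,
      C • V.quadraticTwist ((((-1 : ℤ) ^ (p / 2) * p : ℤ)) : ℚ) = W := by
    push_cast; exact hCW
  haveI : NeZero (2 : ℚ) := ⟨two_ne_zero⟩
  obtain ⟨e, he, -, heneg⟩ := exists_addEquiv_geomPrimaryTorsion_of_model_twist_sign p V hd0 hCW'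
  obtain ⟨L, hL⟩ :=
    exists_localDatum_transport (X2.GreenbergVatsalReductionDatum.reductionDatum V p hpv hΔ) e he
  have heneg' : ∀ σ : absoluteGaloisGroup ℚ,
      σ • geomSqrt ((-1 : ℚ) ^ (p / 2) * p) = -geomSqrt ((-1 : ℚ) ^ (p / 2) * p) →
        ∀ m, e (σ • m) = -(σ • e m) := by
    intro σ hσ
    refine heneg σ ?_
    push_cast
    exact hσ
  exact ⟨L, isRamifiedOrdinaryLine_of_transport_reductionDatum p hp2 V hpv hΔ hV.2 hd e he heneg L hL,
    gr_invariants_eq_zero_of_transport_reductionDatum p κ hp2 V hpv hΔ e heneg' L hL⟩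

variable {p} {W : WeierstrassCurve ℚ} [W.IsElliptic] [W.IsGloballyMinimal]

/-- **X4♯(G-ord) ∩ `I₀*` (every odd `p`): a ramified ordinary line with `(E[p^∞]/C)^{ker κ ⊓ I_v} = 0`
EXISTS** at the place `v ∋ p`, for every `ℤ_p`-extension `κ` of `ℚ` — the GV Remark-(2.9) hypothesis
`h0` of `GreenbergVatsalTorsionRamifiedQuotient` / `GreenbergVatsalTransferRamifiedQuotient` is
DISCHARGED on these rows (with `hplus` = `IsRamifiedOrdinaryLine.divisible`). X4♯ stays
CONSTRUCTION-SHAPED; nothing booked. [cite: GreenbergVatsal2000, §2 Remark (2.9)]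
[cite: EmertonPollackWeston2006, §3.1 (eq:ordes) (arXiv:math/0404484 p. 17)] -/
theorem ClassX4Gord.exists_isRamifiedOrdinaryLine_gr_invariants_eq_zero (hX : ClassX4Gord W p)
    (he : semistabilityIndex W p = 2) (hpv : ((p : ℕ) : 𝓞 ℚ) ∈ v.asIdeal) :
    ∃ L : LocalDatum ℚ ↥(W.geomPrimaryTorsion p) v, IsRamifiedOrdinaryLine W p L ∧
      ∀ a ∈ invariants (inertiaIn κ.kerSubgroup v) L.Gr, a = 0 := by
  obtain ⟨V, _, _, C, hord, hC⟩ := ClassX4Gord.exists_goodOrd_pStar_twist_model W p hX he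
  exact exists_isRamifiedOrdinaryLine_gr_invariants_eq_zero_of_goodOrd_pStar_twist p κ hX.addv.1 V
    ⟨C, hC⟩ hord hpv

/-- **X3♯(G-ord) ∩ `I₀*` (REDUCIBLE `E[p]`, `p` odd): a ramified ordinary line with
`(E[p^∞]/C)^{ker κ ⊓ I_v} = 0` EXISTS** at `v ∋ p`, for every `ℤ_p`-extension `κ` of `ℚ`. X3♯ stays
as labelled; nothing booked. [cite: GreenbergVatsal2000, §2 Remark (2.9)]
[cite: EmertonPollackWeston2006, §3.1 (eq:ordes) (arXiv:math/0404484 p. 17)] -/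
theorem ClassX3Gord.exists_isRamifiedOrdinaryLine_gr_invariants_eq_zero (hp2 : p ≠ 2)
    (hX : ClassX3Gord W p) (he : semistabilityIndex W p = 2) (hpv : ((p : ℕ) : 𝓞 ℚ) ∈ v.asIdeal) :
    ∃ L : LocalDatum ℚ ↥(W.geomPrimaryTorsion p) v, IsRamifiedOrdinaryLine W p L ∧
      ∀ a ∈ invariants (inertiaIn κ.kerSubgroup v) L.Gr, a = 0 := by
  obtain ⟨V, _, _, C, hord, hC⟩ := ClassX3Gord.exists_goodOrd_pStar_twist_model W p hp2 hX he
  exact exists_isRamifiedOrdinaryLine_gr_invariants_eq_zero_of_goodOrd_pStar_twist p κ hp2 V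
    ⟨C, hC⟩ hord hpv

end Rat

end Summit.BirchSwinnertonDyer.Rank1Residual.Additive

/-! ### §3 The (M) rows: the Tate-datum transport (p07's `RamifiedOrdinaryLinePotMult`, mod A40/A41) -/

namespace Summit.BirchSwinnertonDyer.Rank1Residual.AdditivePotMult

open Summit.BirchSwinnertonDyer.Rank1Residual.Additive
  Summit.BirchSwinnertonDyer.Rank1Residual.GaloisImage.RamifiedOrdinaryLineTwist
  RamifiedOrdinaryLinePotMult

section Generic

variable {p : ℕ} [hp : Fact p.Prime] {v : HeightOneSpectrum (𝓞 ℚ)} {W : WeierstrassCurve ℚ}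

/-- **ONE inertia element of `H` acting as `−1` modulo `C` kills `H⁰(H ⊓ I_v, E[p^∞]/C)`** (`p` odd):
if `res τ ∈ H`, `τ ∈ I_{ℚ_v}`, and `res τ • x + x ∈ C` for every `x ∈ E[p^∞]`, then every element of
`E[p^∞]/C` fixed by `H ⊓ I_v` is `0` (`res τ • m − m ∈ C` and `res τ • m + m ∈ C` give `2m ∈ C`, hence
`m ∈ C` — p10's `mem_of_two_nsmul_mem`). [cite: GreenbergVatsal2000, §2 Remark (2.9)] -/
theorem gr_invariants_eq_zero_of_smul_add_mem (hp2 : p ≠ 2) (L : LocalDatum ℚ (W.geomPrimaryTorsion p) v)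
    (H : Subgroup (absoluteGaloisGroup ℚ))
    {τ : absoluteGaloisGroup (v.adicCompletion ℚ)} (hτ : τ ∈ absInertia (v.adicCompletion ℚ))
    (hτH : absGaloisRestrict ℚ (v.adicCompletion ℚ) τ ∈ H)
    (hplus : ∀ x : W.geomPrimaryTorsion p, absGaloisRestrict ℚ (v.adicCompletion ℚ) τ • x + x ∈ L.plus) :
    ∀ a ∈ invariants (inertiaIn H v) L.Gr, a = 0 := by
  intro a ha
  obtain ⟨m, rfl⟩ := L.grMk_surjective a
  set x := absGaloisRestrict ℚ (v.adicCompletion ℚ) τ with hx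
  have hxI : x ∈ inertia v := Subgroup.mem_map.2 ⟨τ, hτ, rfl⟩
  have hxD : x ∈ decomp v := (mem_decomp_iff v x).2 ⟨τ, rfl⟩
  let xI : inertiaIn H v := ⟨⟨x, hxD⟩, (mem_inertiaIn_iff H v _).2 ⟨hτH, hxI⟩⟩
  have hfix : xI • L.grMk m = L.grMk m := (mem_invariants_iff _).1 ha xI
  rw [Subgroup.smul_def, LocalDatum.smul_grMk] at hfix
  change L.grMk (x • m) = L.grMk m at hfix
  have hsub : x • m - m ∈ L.plus := by
    rw [← L.ker_grMk, AddMonoidHom.mem_ker, map_sub, hfix, sub_self]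
  have h2m : (2 : ℕ) • m ∈ L.plus := by
    have hsplit : (2 : ℕ) • m = (x • m + m) - (x • m - m) := by rw [two_nsmul]; abel
    rw [hsplit]
    exact sub_mem (hplus m) hsub
  rw [← AddMonoidHom.mem_ker, L.ker_grMk]
  exact Additive.mem_of_two_nsmul_mem hp2 _ h2m

end Generic

section Classes

variable {W : WeierstrassCurve ℚ} [W.IsElliptic] {p : ℕ} [hp : Fact p.Prime] (κ : ZpExtension ℚ p)

/-- **pot-mult(p), odd `p`: a ramified ordinary line with `(E[p^∞]/C)^{ker κ ⊓ I_v} = 0` EXISTS at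
`v ∋ p`** (mod A40/A41, any `ℤ_p`-extension `κ`): p07's line of the `p*`-twist model with its QUOTIENT
SHAPE, and FILE 3's inertia element of `ker κ` flipping `√p*` — which lies OUTSIDE `galRange ℚ(√p*)`
(it moves the embedded `θ`, `θ² = p*`, a second square root of `p*`: `θ = ±√p*`), hence acts as `−1`
modulo `C`. [cite: GreenbergVatsal2000, §2 Remark (2.9)] [cite: EmertonPollackWeston2006, §3.1 (eq:ordes) (arXiv:math/0404484 p. 17)]
[cite: SilvermanATAEC1994, Ch. V Thm. 5.3, Cor. 5.4] -/
theorem PotMult.exists_isRamifiedOrdinaryLine_gr_invariants_eq_zero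
    (hT40 : Silverman1994_thmV53_tateUniformisation.{0})
    (hT41 : Silverman1994_thmV53_corV54_tateUniformisation.{0}) (hpm : PotMult W p) (hp2 : p ≠ 2)
    {v : HeightOneSpectrum (𝓞 ℚ)} (hv : ((p : ℕ) : 𝓞 ℚ) ∈ v.asIdeal) :
    ∃ L : LocalDatum ℚ (W.geomPrimaryTorsion p) v, IsRamifiedOrdinaryLine W p L ∧
      ∀ a ∈ invariants (inertiaIn κ.kerSubgroup v) L.Gr, a = 0 := by
  obtain ⟨V, _, _, C, hV, hC⟩ := hpm.exists_mult_pStar_twist_model hp2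
  obtain ⟨K, _, _, hK2, θ, hθ, hθ2⟩ := exists_numberField_sq_eq_pStar hp2
  obtain ⟨L, hL, hshape, -⟩ := exists_isRamifiedOrdinaryLine_shape_of_mult_twist V K hK2 hθ hθ2 p hC
    hT40 hT41 hp2 hV hv (valuation_pStar p v hv)
  obtain ⟨τ, hτ, hκτ, hflip⟩ :=
    exists_mem_absInertia_kappa_eq_one_smul_geomSqrt_pStar_eq_neg p κ hp2 hv
  refine ⟨L, hL, gr_invariants_eq_zero_of_smul_add_mem hp2 L κ.kerSubgroup hτ
    (ZpExtension.mem_kerSubgroup.2 hκτ) ((hshape τ hτ).2 ?_)⟩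
  -- `res τ` moves `j(θ)`: `j(θ) = ±√p*` and `res τ • √p* = −√p*`
  refine not_mem_galRange_of_smul_embIntoClosure_ne K (θ := θ) fun hfixθ ↦ ?_
  set g := absGaloisRestrict ℚ (v.adicCompletion ℚ) τ with hg
  have hsq : embIntoClosure (K := ℚ) K θ ^ 2 = geomSqrt ((-1 : ℚ) ^ (p / 2) * p) ^ 2 :=
    (embIntoClosure_sq K hθ2).trans (geomSqrt_sq ((-1 : ℚ) ^ (p / 2) * p)).symm
  have hne : geomSqrt ((-1 : ℚ) ^ (p / 2) * (p : ℚ)) ≠ 0 := by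
    refine geomSqrt_ne_zero (mul_ne_zero (pow_ne_zero _ (neg_ne_zero.2 one_ne_zero)) ?_)
    exact_mod_cast hp.out.ne_zero
  have h2 : (2 : AlgebraicClosure ℚ) ≠ 0 := two_ne_zero
  rcases eq_or_eq_neg_of_sq_eq_sq _ _ hsq with h | h
  · rw [h] at hfixθ
    rw [hfixθ] at hflip
    exact hne (by linear_combination (1 / 2 : AlgebraicClosure ℚ) * hflip)
  · rw [h, smul_neg] at hfixθ
    rw [neg_inj.1 hfixθ] at hflip
    exact hne (by linear_combination (1 / 2 : AlgebraicClosure ℚ) * hflip)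

/-- **X4(M), EVERY odd `p` (`p = 3` included): a ramified ordinary line with `(E[p^∞]/C)^{ker κ ⊓ I_v} = 0`
EXISTS** (mod A40/A41) — GV Remark (2.9)'s hypothesis `h0` DISCHARGED on the X4(M) rows. X4(M) stays
CONSTRUCTION-SHAPED; nothing booked. [cite: GreenbergVatsal2000, §2 Remark (2.9)]
[cite: EmertonPollackWeston2006, §3.1 (eq:ordes) (arXiv:math/0404484 p. 17)] -/
theorem ClassX4M.exists_isRamifiedOrdinaryLine_gr_invariants_eq_zero
    (hT40 : Silverman1994_thmV53_tateUniformisation.{0})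
    (hT41 : Silverman1994_thmV53_corV54_tateUniformisation.{0}) (hX : ClassX4M W p)
    {v : HeightOneSpectrum (𝓞 ℚ)} (hv : ((p : ℕ) : 𝓞 ℚ) ∈ v.asIdeal) :
    ∃ L : LocalDatum ℚ (W.geomPrimaryTorsion p) v, IsRamifiedOrdinaryLine W p L ∧
      ∀ a ∈ invariants (inertiaIn κ.kerSubgroup v) L.Gr, a = 0 :=
  (ClassX4M.potMult W p hX).exists_isRamifiedOrdinaryLine_gr_invariants_eq_zero κ hT40 hT41
    hX.p_ne_two hv

/-- **X3♯(M), odd `p`: a ramified ordinary line with `(E[p^∞]/C)^{ker κ ⊓ I_v} = 0` EXISTS** (mod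
A40/A41; reducibility of `E[p]` irrelevant). [cite: GreenbergVatsal2000, §2 Remark (2.9)]
[cite: EmertonPollackWeston2006, §3.1 (eq:ordes) (arXiv:math/0404484 p. 17)] -/
theorem ClassX3M.exists_isRamifiedOrdinaryLine_gr_invariants_eq_zero [W.IsGloballyMinimal]
    (hT40 : Silverman1994_thmV53_tateUniformisation.{0})
    (hT41 : Silverman1994_thmV53_corV54_tateUniformisation.{0}) (hX : ClassX3M W p)
    {v : HeightOneSpectrum (𝓞 ℚ)} (hv : ((p : ℕ) : 𝓞 ℚ) ∈ v.asIdeal) :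
    ∃ L : LocalDatum ℚ (W.geomPrimaryTorsion p) v, IsRamifiedOrdinaryLine W p L ∧
      ∀ a ∈ invariants (inertiaIn κ.kerSubgroup v) L.Gr, a = 0 :=
  (ClassX3M.potMult W p hX).exists_isRamifiedOrdinaryLine_gr_invariants_eq_zero κ hT40 hT41
    (ClassX3M.p_ne_two W p hX) hv

end Classes

end Summit.BirchSwinnertonDyer.Rank1Residual.AdditivePotMult

end
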